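import Mathlib
import HarnessLib

/-!
# `NoHeavyLowerTail` (stmt-CriticalPhenomena-4575) — every weighted edge set splits into a leaf-peeling forest and locally dominated chords

Support file (prover `prim-gen-swap` gen 9; `--supports stmt-CriticalPhenomena-4575`).  No definitions, no named facts, no sorries; Mathlib only.

The mixed certificate `StarSet.setCS_twoPortStarMultigraph_mixed_levelTwo_of_U1` wants the classes of a two-port star multigraph listed as a
forest in leaf-peeling order (`hforest`) followed by chords each dominated at both ports by an adjacent forest class off the chord (`hdomF`).
Such a split always exists (Kruskal: insert the classes by decreasing weight; a class with an as yet uncovered port becomes the FIRST forest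
class with that port as its leaf end, otherwise it becomes a chord — any forest class at its ports is heavier and, port pairs being distinct,
leaves the chord):

* `StarSet.forest_split_core` — for a finite set `E` of non-diagonal edges of `Fin n` and a weight `t` (smaller = heavier), an enumeration
  `Q, Q' : Fin (Mf + Mc) → Fin n` of `E` (bijective on edges) with the leaf-peeling property on the `Fin.castAdd` part and the domination property
  (`t(forest class) ≤ t(chord)`) on the `Fin.natAdd` part;
* `StarSet.exists_forest_chord_split` — star-level wrapper: classes `cls : Fin m → Fin (Mf + Mc)`, ports `P, P'` (stars' ports possibly
  swapped), distinct port pairs (`hnopar`), `hforest`, and `hdomF` with the class weights `Π_{cls i = κ}(1 − θ_i)`.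
-/

namespace Summit.CriticalPhenomena.PercolationContinuityZ3.Theorems

open Finset
open scoped BigOperators

namespace StarSet

variable {n : ℕ}

/-- **Forest/chord split of a weighted edge set.**  See the file header. [folklore: Kruskal] -/
theorem forest_split_core (t : Sym2 (Fin n) → ℝ) :
    ∀ (N : ℕ) (E : Finset (Sym2 (Fin n))), E.card = N → (∀ e ∈ E, ¬ e.IsDiag) →
    ∃ (Mf Mc : ℕ) (Q Q' : Fin (Mf + Mc) → Fin n),
      (∀ κ, Q κ ≠ Q' κ) ∧ (∀ κ, s(Q κ, Q' κ) ∈ E) ∧ (∀ e ∈ E, ∃ κ, s(Q κ, Q' κ) = e) ∧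
      (∀ κ κ', s(Q κ, Q' κ) = s(Q κ', Q' κ') → κ = κ') ∧
      (∀ K I : Fin Mf, K < I → Q' (Fin.castAdd Mc K) ≠ Q (Fin.castAdd Mc I) ∧ Q' (Fin.castAdd Mc K) ≠ Q' (Fin.castAdd Mc I)) ∧
      (∀ K : Fin Mc, ∀ d : Fin n, (d = Q (Fin.natAdd Mf K) ∨ d = Q' (Fin.natAdd Mf K)) →
        ∃ I : Fin Mf, (Q (Fin.castAdd Mc I) = d ∨ Q' (Fin.castAdd Mc I) = d) ∧
          (Q (Fin.castAdd Mc I) ∉ ({Q (Fin.natAdd Mf K), Q' (Fin.natAdd Mf K)} : Finset (Fin n)) ∨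
            Q' (Fin.castAdd Mc I) ∉ ({Q (Fin.natAdd Mf K), Q' (Fin.natAdd Mf K)} : Finset (Fin n))) ∧
          t s(Q (Fin.castAdd Mc I), Q' (Fin.castAdd Mc I)) ≤ t s(Q (Fin.natAdd Mf K), Q' (Fin.natAdd Mf K))) := by
  intro N
  induction N with
  | zero =>
    intro E hE _
    refine ⟨0, 0, Fin.elim0, Fin.elim0, fun κ => κ.elim0, fun κ => κ.elim0, fun e he => ?_, fun κ => κ.elim0, fun K => K.elim0, fun K => K.elim0⟩
    rw [Finset.card_eq_zero] at hE; subst hE; exact absurd he (Finset.notMem_empty e)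
  | succ N ih =>
    intro E hE hdiag
    have hne : E.Nonempty := by rw [← Finset.card_pos, hE]; exact Nat.succ_pos N
    -- the lightest class (largest `t`)
    obtain ⟨e₀, he₀, hmax⟩ := Finset.exists_max_image E t hne
    set E' := E.erase e₀ with hE'
    have hE'card : E'.card = N := by rw [Finset.card_erase_of_mem he₀, hE]; rfl
    obtain ⟨Mf, Mc, Q, Q', hQQ', hmem, hsurj, hinj, hforest, hdom⟩ := ih E' hE'card (fun e he => hdiag e (Finset.mem_of_mem_erase he))
    -- endpoints of `e₀`
    obtain ⟨⟨a, b⟩, hab0⟩ := Quot.exists_rep e₀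
    have hab : e₀ = s(a, b) := hab0.symm
    have hab' : a ≠ b := fun h => hdiag e₀ he₀ (by rw [hab, h]; exact Sym2.mk_isDiag_iff.2 rfl)
    have he₀E' : e₀ ∉ E' := Finset.notMem_erase e₀ E
    have hmemE : ∀ κ, s(Q κ, Q' κ) ∈ E := fun κ => Finset.mem_of_mem_erase (hmem κ)
    have hneq₀ : ∀ κ, s(Q κ, Q' κ) ≠ e₀ := fun κ h => he₀E' (h ▸ hmem κ)
    -- general facts for the old classes versus `e₀ = s(a,b)`
    have hoff : ∀ κ, (Q κ = a ∨ Q' κ = a) → (Q κ ∉ ({a, b} : Finset (Fin n)) ∨ Q' κ ∉ ({a, b} : Finset (Fin n))) := by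
      intro κ h
      rcases h with h | h
      · right
        intro hm
        simp only [mem_insert, mem_singleton] at hm
        rcases hm with hm | hm
        · exact hQQ' κ (h.trans hm.symm)
        · exact hneq₀ κ (by rw [hab, h, hm])
      · left
        intro hm
        simp only [mem_insert, mem_singleton] at hm
        rcases hm with hm | hm
        · exact hQQ' κ (hm.trans h.symm)
        · exact hneq₀ κ (by rw [hab, hm, h, Sym2.eq_swap])
    have hoff' : ∀ κ, (Q κ = b ∨ Q' κ = b) → (Q κ ∉ ({a, b} : Finset (Fin n)) ∨ Q' κ ∉ ({a, b} : Finset (Fin n))) := by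
      intro κ h
      rcases h with h | h
      · right
        intro hm
        simp only [mem_insert, mem_singleton] at hm
        rcases hm with hm | hm
        · exact hneq₀ κ (by rw [hab, h, hm, Sym2.eq_swap])
        · exact hQQ' κ (h.trans hm.symm)
      · left
        intro hm
        simp only [mem_insert, mem_singleton] at hm
        rcases hm with hm | hm
        · exact hneq₀ κ (by rw [hab, hm, h])
        · exact hQQ' κ (hm.trans h.symm)
    have htmax : ∀ κ, t s(Q κ, Q' κ) ≤ t e₀ := fun κ => hmax _ (hmemE κ)
    by_cases hcov : (∃ I : Fin Mf, Q (Fin.castAdd Mc I) = a ∨ Q' (Fin.castAdd Mc I) = a) ∧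
        (∃ I : Fin Mf, Q (Fin.castAdd Mc I) = b ∨ Q' (Fin.castAdd Mc I) = b)
    · -- CHORD: both ports already covered by the forest
      obtain ⟨⟨Ia, hIa⟩, ⟨Ib, hIb⟩⟩ := hcov
      refine ⟨Mf, Mc + 1, Fin.addCases (fun I => Q (Fin.castAdd Mc I)) (Fin.cons a fun K => Q (Fin.natAdd Mf K)),
        Fin.addCases (fun I => Q' (Fin.castAdd Mc I)) (Fin.cons b fun K => Q' (Fin.natAdd Mf K)), ?_, ?_, ?_, ?_, ?_, ?_⟩
      · intro κ
        induction κ using Fin.addCases with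
        | left I => simpa using hQQ' _
        | right K =>
          rcases Fin.eq_zero_or_eq_succ K with rfl | ⟨K', rfl⟩
          · simpa using hab'
          · simpa using hQQ' _
      · intro κ
        induction κ using Fin.addCases with
        | left I => simpa using hmemE _
        | right K =>
          rcases Fin.eq_zero_or_eq_succ K with rfl | ⟨K', rfl⟩
          · simpa [← hab] using he₀
          · simpa using hmemE _
      · intro e he
        by_cases hee : e = e₀
        · refine ⟨Fin.natAdd Mf 0, ?_⟩; simp [hee, hab]
        · obtain ⟨κ, hκ⟩ := hsurj e (Finset.mem_erase.2 ⟨hee, he⟩)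
          induction κ using Fin.addCases with
          | left I => exact ⟨Fin.castAdd (Mc + 1) I, by simpa using hκ⟩
          | right K => exact ⟨Fin.natAdd Mf K.succ, by simpa using hκ⟩
      · intro κ κ' h
        induction κ using Fin.addCases with
        | left I =>
          induction κ' using Fin.addCases with
          | left I' =>
            have hII' := hinj _ _ (by simpa using h)
            have hII : I = I' := Fin.ext (by simpa using congrArg Fin.val hII')
            subst hII; rfl
          | right K' =>
            rcases Fin.eq_zero_or_eq_succ K' with rfl | ⟨K'', rfl⟩
            · exact absurd (by simpa [hab] using h) (hneq₀ (Fin.castAdd Mc I))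
            · have := hinj _ _ (by simpa using h)
              exact absurd this (fun h' => by
                have hv := congrArg Fin.val h'; simp at hv; omega)
        | right K =>
          rcases Fin.eq_zero_or_eq_succ K with rfl | ⟨K'', rfl⟩
          · induction κ' using Fin.addCases with
            | left I' => exact absurd (by simpa [hab] using h.symm) (hneq₀ (Fin.castAdd Mc I'))
            | right K' =>
              rcases Fin.eq_zero_or_eq_succ K' with rfl | ⟨K'', rfl⟩
              · rfl
              · exact absurd (by simpa [hab] using h.symm) (hneq₀ (Fin.natAdd Mf K''))
          · induction κ' using Fin.addCases with
            | left I' =>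
              have := hinj _ _ (by simpa using h)
              exact absurd this (fun h' => by have hv := congrArg Fin.val h'; simp at hv; omega)
            | right K' =>
              rcases Fin.eq_zero_or_eq_succ K' with rfl | ⟨K''', rfl⟩
              · exact absurd (by simpa [hab] using h) (hneq₀ (Fin.natAdd Mf K''))
              · have := hinj _ _ (by simpa using h)
                have hv := congrArg Fin.val this; simp at hv
                have : K'' = K''' := Fin.ext (by omega)
                subst this; rfl
      · intro K I hKI; simpa using hforest K I hKI
      · intro K d hd
        rcases Fin.eq_zero_or_eq_succ K with rfl | ⟨K', rfl⟩
        · -- the new chord `e₀`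
          simp only [Fin.addCases_right, Fin.cons_zero] at hd ⊢
          rcases hd with rfl | rfl
          · exact ⟨Ia, by simpa using hIa, by simpa using hoff _ hIa, by simpa [← hab] using htmax (Fin.castAdd Mc Ia)⟩
          · exact ⟨Ib, by simpa using hIb, by simpa using hoff' _ hIb, by simpa [← hab] using htmax (Fin.castAdd Mc Ib)⟩
        · have hd' : d = Q (Fin.natAdd Mf K') ∨ d = Q' (Fin.natAdd Mf K') := by simpa using hd
          obtain ⟨I, h1, h2, h3⟩ := hdom K' d hd'
          exact ⟨I, by simpa using h1, by simpa using h2, by simpa using h3⟩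
    · -- FOREST: a port of `e₀` is uncovered; it becomes the leaf end of the FIRST forest class
      -- choose the uncovered end as `lf` and the other as `rt`
      obtain ⟨lf, rt, hlr, he₀', hunc⟩ : ∃ lf rt : Fin n, lf ≠ rt ∧ e₀ = s(rt, lf) ∧
          ¬ (∃ I : Fin Mf, Q (Fin.castAdd Mc I) = lf ∨ Q' (Fin.castAdd Mc I) = lf) := by
        by_cases ha : ∃ I : Fin Mf, Q (Fin.castAdd Mc I) = a ∨ Q' (Fin.castAdd Mc I) = a
        · exact ⟨b, a, hab'.symm, hab, fun hb => hcov ⟨ha, hb⟩⟩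
        · exact ⟨a, b, hab', by rw [hab, Sym2.eq_swap], ha⟩
      refine ⟨Mf + 1, Mc, Fin.addCases (Fin.cons rt fun I => Q (Fin.castAdd Mc I)) (fun K => Q (Fin.natAdd Mf K)),
        Fin.addCases (Fin.cons lf fun I => Q' (Fin.castAdd Mc I)) (fun K => Q' (Fin.natAdd Mf K)), ?_, ?_, ?_, ?_, ?_, ?_⟩
      · intro κ
        induction κ using Fin.addCases with
        | left I =>
          rcases Fin.eq_zero_or_eq_succ I with rfl | ⟨I', rfl⟩
          · simpa using hlr.symm
          · simpa using hQQ' _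
        | right K => simpa using hQQ' _
      · intro κ
        induction κ using Fin.addCases with
        | left I =>
          rcases Fin.eq_zero_or_eq_succ I with rfl | ⟨I', rfl⟩
          · simpa [← he₀'] using he₀
          · simpa using hmemE _
        | right K => simpa using hmemE _
      · intro e he
        by_cases hee : e = e₀
        · refine ⟨Fin.castAdd Mc 0, ?_⟩; simp [hee, he₀']
        · obtain ⟨κ, hκ⟩ := hsurj e (Finset.mem_erase.2 ⟨hee, he⟩)
          induction κ using Fin.addCases with
          | left I => exact ⟨Fin.castAdd Mc I.succ, by simpa using hκ⟩
          | right K => exact ⟨Fin.natAdd (Mf + 1) K, by simpa using hκ⟩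
      · intro κ κ' h
        induction κ using Fin.addCases with
        | left I =>
          rcases Fin.eq_zero_or_eq_succ I with rfl | ⟨I₁, rfl⟩
          · induction κ' using Fin.addCases with
            | left I' =>
              rcases Fin.eq_zero_or_eq_succ I' with rfl | ⟨I₂, rfl⟩
              · rfl
              · exact absurd (by simpa [he₀'] using h.symm) (hneq₀ (Fin.castAdd Mc I₂))
            | right K' => exact absurd (by simpa [he₀'] using h.symm) (hneq₀ (Fin.natAdd Mf K'))
          · induction κ' using Fin.addCases with
            | left I' =>
              rcases Fin.eq_zero_or_eq_succ I' with rfl | ⟨I₂, rfl⟩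
              · exact absurd (by simpa [he₀'] using h) (hneq₀ (Fin.castAdd Mc I₁))
              · have := hinj _ _ (by simpa using h)
                have hv := congrArg Fin.val this; simp at hv
                have : I₁ = I₂ := Fin.ext (by omega)
                subst this; rfl
            | right K' =>
              have := hinj _ _ (by simpa using h)
              exact absurd this (fun h' => by have hv := congrArg Fin.val h'; simp at hv; omega)
        | right K =>
          induction κ' using Fin.addCases with
          | left I' =>
            rcases Fin.eq_zero_or_eq_succ I' with rfl | ⟨I₂, rfl⟩
            · exact absurd (by simpa [he₀'] using h) (hneq₀ (Fin.natAdd Mf K))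
            · have := hinj _ _ (by simpa using h)
              exact absurd this (fun h' => by have hv := congrArg Fin.val h'; simp at hv; omega)
          | right K' =>
            have hKK' := hinj _ _ (by simpa using h)
            have hKK : K = K' := Fin.ext (by have hv := congrArg Fin.val hKK'; simp at hv; omega)
            subst hKK; rfl
      · intro K I hKI
        rcases Fin.eq_zero_or_eq_succ I with rfl | ⟨I', rfl⟩
        · exact absurd hKI (Fin.not_lt_zero K)
        · rcases Fin.eq_zero_or_eq_succ K with rfl | ⟨K', rfl⟩
          · -- the new leaf end `lf` is uncovered by the old forest
            simp only [Fin.addCases_left, Fin.cons_zero, Fin.cons_succ]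
            have h1 : ¬ (Q (Fin.castAdd Mc I') = lf ∨ Q' (Fin.castAdd Mc I') = lf) := fun h => hunc ⟨I', h⟩
            simp only [not_or] at h1
            exact ⟨fun h => h1.1 h.symm, fun h => h1.2 h.symm⟩
          · have := hforest K' I' (Fin.succ_lt_succ_iff.1 hKI)
            simpa using this
      · intro K d hd
        have hd' : d = Q (Fin.natAdd Mf K) ∨ d = Q' (Fin.natAdd Mf K) := by simpa using hd
        obtain ⟨I, h1, h2, h3⟩ := hdom K d hd'
        exact ⟨I.succ, by simpa using h1, by simpa using h2, by simpa using h3⟩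


/-- **Forest ⊔ locally dominated chords for any two-port star system.**  Stars `i` with distinct ports `p i ≠ p' i` and weights `θ i`; the classes
(= distinct port pairs) can be indexed by `Fin (Mf + Mc)` with ports `P, P'` (each star's ports possibly swapped) so that the first `Mf` classes
satisfy the leaf-peeling hypothesis `hforest` and the last `Mc` the domination hypothesis `hdomF` of `StarSet.mwf_supply_U0` /
`StarSet.setCS_twoPortStarMultigraph_mixed_levelTwo_of_U1`. [folklore: Kruskal] -/
theorem exists_forest_chord_split {m : ℕ} (p p' : Fin m → Fin n) (hpp' : ∀ i, p i ≠ p' i) (θ : Fin m → ℝ) :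
    ∃ (Mf Mc : ℕ) (cls : Fin m → Fin (Mf + Mc)) (P P' : Fin (Mf + Mc) → Fin n),
      (∀ i, (P (cls i) = p i ∧ P' (cls i) = p' i) ∨ (P (cls i) = p' i ∧ P' (cls i) = p i)) ∧
      (∀ κ, P κ ≠ P' κ) ∧
      (∀ I K : Fin (Mf + Mc), I ≠ K → ¬ ((P K = P I ∨ P K = P' I) ∧ (P' K = P I ∨ P' K = P' I))) ∧
      (∀ K I : Fin Mf, K < I → P' (Fin.castAdd Mc K) ≠ P (Fin.castAdd Mc I) ∧ P' (Fin.castAdd Mc K) ≠ P' (Fin.castAdd Mc I)) ∧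
      (∀ K : Fin Mc, ∀ d : Fin n, (d = P (Fin.natAdd Mf K) ∨ d = P' (Fin.natAdd Mf K)) →
        ∃ I : Fin Mf, (P (Fin.castAdd Mc I) = d ∨ P' (Fin.castAdd Mc I) = d) ∧
          (P (Fin.castAdd Mc I) ∉ ({P (Fin.natAdd Mf K), P' (Fin.natAdd Mf K)} : Finset (Fin n)) ∨
            P' (Fin.castAdd Mc I) ∉ ({P (Fin.natAdd Mf K), P' (Fin.natAdd Mf K)} : Finset (Fin n))) ∧
          ∏ i ∈ Finset.univ.filter (fun i => cls i = Fin.castAdd Mc I), (1 - θ i) ≤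
            ∏ i ∈ Finset.univ.filter (fun i => cls i = Fin.natAdd Mf K), (1 - θ i)) := by
  classical
  set E : Finset (Sym2 (Fin n)) := univ.image (fun i => s(p i, p' i)) with hEdef
  set t : Sym2 (Fin n) → ℝ := fun e => ∏ i ∈ univ.filter (fun i => s(p i, p' i) = e), (1 - θ i) with ht
  have hdiag : ∀ e ∈ E, ¬ e.IsDiag := by
    intro e he
    obtain ⟨i, -, rfl⟩ := mem_image.1 he
    rw [Sym2.mk_isDiag_iff]; exact hpp' i
  obtain ⟨Mf, Mc, Q, Q', hQQ', hmem, hsurj, hinj, hforest, hdom⟩ := forest_split_core t E.card E rfl hdiag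
  have hex : ∀ i : Fin m, ∃ κ, s(Q κ, Q' κ) = s(p i, p' i) := fun i => hsurj _ (mem_image.2 ⟨i, mem_univ _, rfl⟩)
  refine ⟨Mf, Mc, fun i => Classical.choose (hex i), Q, Q', ?_, hQQ', ?_, hforest, ?_⟩
  · intro i
    have h := Classical.choose_spec (hex i)
    exact Sym2.eq_iff.1 h
  · intro I K hIK hpar
    apply hIK
    apply (hinj K I _).symm
    obtain ⟨h1, h2⟩ := hpar
    rcases h1 with h1 | h1 <;> rcases h2 with h2 | h2
    · exact absurd (h1.trans h2.symm) (hQQ' K)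
    · rw [h1, h2]
    · rw [h1, h2, Sym2.eq_swap]
    · exact absurd (h1.trans h2.symm) (hQQ' K)
  · intro K d hd
    obtain ⟨I, h1, h2, h3⟩ := hdom K d hd
    refine ⟨I, h1, h2, ?_⟩
    -- the class weights are the weights `t` of the corresponding edges
    have hcls : ∀ κ, (univ.filter fun i => Classical.choose (hex i) = κ) = univ.filter (fun i => s(p i, p' i) = s(Q κ, Q' κ)) := by
      intro κ
      ext i
      simp only [mem_filter, mem_univ, true_and]
      constructor
      · intro h; rw [← h]; exact (Classical.choose_spec (hex i)).symm
      · intro h; exact hinj _ _ ((Classical.choose_spec (hex i)).trans h)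
    have htκ : ∀ κ, ∏ i ∈ univ.filter (fun i => Classical.choose (hex i) = κ), (1 - θ i) = t s(Q κ, Q' κ) := by
      intro κ; rw [hcls κ]
    rw [htκ, htκ]; exact h3

/-- `StarSet.exists_forest_chord_split` with the (needed) surjectivity of `cls`: every class index carries a star, so star-level hypotheses
(ports in `A`, domination by the observer, …) transfer to the class ports `P κ, P' κ`. [folklore: Kruskal] -/
theorem exists_forest_chord_split_surj {m : ℕ} (p p' : Fin m → Fin n) (hpp' : ∀ i, p i ≠ p' i) (θ : Fin m → ℝ) :
    ∃ (Mf Mc : ℕ) (cls : Fin m → Fin (Mf + Mc)) (P P' : Fin (Mf + Mc) → Fin n),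
      (∀ κ, ∃ i, cls i = κ) ∧
      (∀ i, (P (cls i) = p i ∧ P' (cls i) = p' i) ∨ (P (cls i) = p' i ∧ P' (cls i) = p i)) ∧
      (∀ κ, P κ ≠ P' κ) ∧
      (∀ I K : Fin (Mf + Mc), I ≠ K → ¬ ((P K = P I ∨ P K = P' I) ∧ (P' K = P I ∨ P' K = P' I))) ∧
      (∀ K I : Fin Mf, K < I → P' (Fin.castAdd Mc K) ≠ P (Fin.castAdd Mc I) ∧ P' (Fin.castAdd Mc K) ≠ P' (Fin.castAdd Mc I)) ∧
      (∀ K : Fin Mc, ∀ d : Fin n, (d = P (Fin.natAdd Mf K) ∨ d = P' (Fin.natAdd Mf K)) →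
        ∃ I : Fin Mf, (P (Fin.castAdd Mc I) = d ∨ P' (Fin.castAdd Mc I) = d) ∧
          (P (Fin.castAdd Mc I) ∉ ({P (Fin.natAdd Mf K), P' (Fin.natAdd Mf K)} : Finset (Fin n)) ∨
            P' (Fin.castAdd Mc I) ∉ ({P (Fin.natAdd Mf K), P' (Fin.natAdd Mf K)} : Finset (Fin n))) ∧
          ∏ i ∈ Finset.univ.filter (fun i => cls i = Fin.castAdd Mc I), (1 - θ i) ≤
            ∏ i ∈ Finset.univ.filter (fun i => cls i = Fin.natAdd Mf K), (1 - θ i)) := by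
  classical
  set E : Finset (Sym2 (Fin n)) := univ.image (fun i => s(p i, p' i)) with hEdef
  set t : Sym2 (Fin n) → ℝ := fun e => ∏ i ∈ univ.filter (fun i => s(p i, p' i) = e), (1 - θ i) with ht
  have hdiag : ∀ e ∈ E, ¬ e.IsDiag := by
    intro e he
    obtain ⟨i, -, rfl⟩ := mem_image.1 he
    rw [Sym2.mk_isDiag_iff]; exact hpp' i
  obtain ⟨Mf, Mc, Q, Q', hQQ', hmem, hsurj, hinj, hforest, hdom⟩ := forest_split_core t E.card E rfl hdiag
  have hex : ∀ i : Fin m, ∃ κ, s(Q κ, Q' κ) = s(p i, p' i) := fun i => hsurj _ (mem_image.2 ⟨i, mem_univ _, rfl⟩)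
  refine ⟨Mf, Mc, fun i => Classical.choose (hex i), Q, Q', ?_, ?_, hQQ', ?_, hforest, ?_⟩
  · intro κ
    obtain ⟨i, -, hi⟩ := mem_image.1 (hmem κ)
    exact ⟨i, hinj _ _ ((Classical.choose_spec (hex i)).trans hi)⟩
  · intro i
    have h := Classical.choose_spec (hex i)
    exact Sym2.eq_iff.1 h
  · intro I K hIK hpar
    apply hIK
    apply (hinj K I _).symm
    obtain ⟨h1, h2⟩ := hpar
    rcases h1 with h1 | h1 <;> rcases h2 with h2 | h2
    · exact absurd (h1.trans h2.symm) (hQQ' K)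
    · rw [h1, h2]
    · rw [h1, h2, Sym2.eq_swap]
    · exact absurd (h1.trans h2.symm) (hQQ' K)
  · intro K d hd
    obtain ⟨I, h1, h2, h3⟩ := hdom K d hd
    refine ⟨I, h1, h2, ?_⟩
    have hcls : ∀ κ, (univ.filter fun i => Classical.choose (hex i) = κ) = univ.filter (fun i => s(p i, p' i) = s(Q κ, Q' κ)) := by
      intro κ
      ext i
      simp only [mem_filter, mem_univ, true_and]
      constructor
      · intro h; rw [← h]; exact (Classical.choose_spec (hex i)).symm
      · intro h; exact hinj _ _ ((Classical.choose_spec (hex i)).trans h)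
    have htκ : ∀ κ, ∏ i ∈ univ.filter (fun i => Classical.choose (hex i) = κ), (1 - θ i) = t s(Q κ, Q' κ) := by
      intro κ; rw [hcls κ]
    rw [htκ, htκ]; exact h3

end StarSet

end Summit.CriticalPhenomena.PercolationContinuityZ3.Theorems
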